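import Summits.AtomisticToContinuum.HydrodynamicLimit.Theorems.AntiMazurCoboundariesCorrectorPressureDecayWindowLocalityCore
import Summits.AtomisticToContinuum.HydrodynamicLimit.Theorems.AntiMazurCoboundariesCorrectorPressureDecayTransfer
import Summits.AtomisticToContinuum.HydrodynamicLimit.Theorems.CorrectorPressureDecay.Negative.DiscreteWindowOfKineticFlux
import Summits.AtomisticToContinuum.HydrodynamicLimit.Theorems.AntiMazurCoboundariesInfluenceLocalityObjects
import Literature.Analysis.FluidPDE.HardSphereAlexander
import Literature.MathematicalPhysics.KineticTheory.HardSphereEulerProofs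

/-!
# Window locality: what FIXED-AMPLITUDE influence locality would buy — the forecast-window pressure
# versus the wall

Route `AntiMazurCoboundaries` of `AtomisticToContinuum/HydrodynamicLimit`, crux stmt-AtomisticToContinuum-14135
(`CorrectorPressureDecay`, "X"), line `almost-invariant-duality`, lead seat c6 — the WINDOW ROUTE of layer 2
(quantifier assembly over the core inequalities of `…WindowLocalityCore`).

Two hypotheses are spelled inline (no new definitions):

* `hL` — FIXED-AMPLITUDE INFLUENCE LOCALITY (eventual in the range): for every `σ < σ₀` there is SOME amplitude
  `lam > 0` such that for ALL horizons `T` and tolerances `δ`, for all ranges `R ≥ R₀(T, δ)` and all large `N`,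
  every flow `Φ` and every family `Ψ` of cluster flows, `∫ exp(lam · #bad) dG_N ≤ e^{δ(N+1)}` (`#bad` = the count of
  `InfluenceLocality`, stmt-13916). It is implied by the eventual form `TrueAnchoredInfection.InfluenceLocalityEventually`
  of the 13916 line (`wl_smallAmplitude_of_eventually`), i.e. by the hypothesis `h₁` of the landed corrector transfer
  `TransferSkeleton.correctorPressureDecay_of_inputs` (p89394) and of
  `ShotNoisePressure.correctorPressureDecay_of_locality_of_forecastWindow` (p116419).
  STATUS (lead c6 audit, `Cruxes/CorrectorPressureDecay/Negative-notes/layer2-cascade-obstruction.md`): `hL` — and a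
  fortiori `InfluenceLocalityEventually` and the typed `∀ lam` crux stmt-13916 — is BELIEVED FALSE: an intruder of
  kinetic energy `E` (LD cost `E/θ`, linear in `E`) arriving from outside the range and dispersed through a tree of
  empty corridors corrupts, through the collision epidemics it seeds, a number of range-`R` forecasts ALSO linear in
  `E` (`≍ κ_th(T,σ)·E/θ` with `κ_th(T,σ) ≍ n_epi(T/2)/(E_leaf + πσ²v_fT + 4log(v_fT/σ))`, `n_epi(t) ≈ e^{t/t_mf}` the
  epidemic size), uniformly in `R`; so the LD rate of the bad fraction is `≤ ε/κ_th(T,σ)` and the bound fails for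
  `lam > lam_c(T,σ) = 1/κ_th(T,σ) → 0` (`σ = 0.3`: `lam_c ≈ 3, 0.13, 6·10⁻³` at `T = 10, 20, 30`) — whereas every
  true-versus-forecast comparison at the exponential scale (this file: amplitude `4κ`; the corrector transfer:
  `12κT/s`) needs it at an amplitude fixed before `δ`, with `T = T(δ) → ∞`. The theorems below are therefore recorded
  for what they ISOLATE: modulo fixed-amplitude locality the forecast-window statement is the wall itself, and without
  it no pathwise localisation of the kinetic window reaches X at the LD level. Contrapositive use: `h₃ ∧ ¬X ⇒ ¬hL`.
* `h₃` — the FORECAST-WINDOW PRESSURE under `G_N` on `𝕋³`, verbatim the third hypothesis of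
  `TransferSkeleton.correctorPressureDecay_of_inputs` / `ShotNoisePressure.correctorPressureDecay_of_locality_of_forecastWindow`
  (the torus image of the N-free core `CellForecastPressureDecay`, stmt-13915, under the static torus→cell transfer).

Results:

* `wl_kineticFlux_of_forecastWindow : hL → h₃ → KineticFluxLdDecay` (stmt-10967; hence X by
  `CorrectorPressureDecayEquivalences.correctorPressureDecay_of_kineticFluxLdDecay`, p99142 — re-derived here from its two landed
  halves to keep the import cone small) — no shot-noise input and no corrector;
* `wl_forecastWindow_of_kineticFlux : hL → KineticFluxLdDecay → h₃` — the converse;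
* `wl_forecastWindow_iff_crux : hL → (h₃ ↔ CorrectorPressureDecay)`.

Proof: `…WindowLocalityCore` at `f = φ ⊗ g∘(scaling)`, `f₂ = φ ⊗ (2g)∘(scaling)` (the target statement is
invoked at the doubled observable `2g`, admissible at amplitude `κ₀` once `κ ≤ κ₀/2`), `lam ≥ 4κ`, the Gibbs law
carried by the good set (`G_N ≪` Liouville), cluster flows from Alexander's theorem on `𝕋³` where a family has to
be chosen, and `½(e^{δ(N+1)} + e^{δ(N+1)}) = e^{δ(N+1)}`.
-/

noncomputable section

open MeasureTheory Set Filter Topology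
open scoped ENNReal

namespace Summit.AtomisticToContinuum.HydrodynamicLimit.Theorems

open Literature.Analysis.FluidPDE
open Literature.MathematicalPhysics.KineticTheory (T3 V3 hsDiameter localGibbsLaw hsDiameter_pos hsDiameter_le
  isProbabilityMeasure_localGibbsLaw)
open Summit.AtomisticToContinuum.HydrodynamicLimit.Theses.AntiMazurCoboundaries (CorrectorPressureDecay
  KineticFluxLdDecay)

namespace WindowLocality

/-! ## Small tools -/

/-- `½(c + c) = c` in `ℝ≥0∞`. [folklore] -/
theorem half_mul_add_self (c : ℝ≥0∞) : 2⁻¹ * (c + c) = c := by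
  rw [← two_mul, ← mul_assoc, ENNReal.inv_mul_cancel two_ne_zero ENNReal.ofNat_ne_top, one_mul]

/-- The homogeneous Gibbs law is carried by the good set of every flow (it is absolutely continuous with respect
to the Liouville measure). [folklore] -/
theorem localGibbsLaw_compl_good (σ a θ : ℝ) (u₀ : V3) (N : ℕ)
    (Φ : HardSphereFlow (Torus.geometry (Fin 3)) (hsDiameter σ N) (N + 1)) :
    localGibbsLaw σ (fun _ => a) (fun _ => u₀) (fun _ => θ) N Φ Φ.goodᶜ = 0 := by
  have hac : localGibbsLaw σ (fun _ => a) (fun _ => u₀) (fun _ => θ) N Φ ≪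
      liouville (Torus.geometry (Fin 3)) (N + 1) (hsDiameter σ N) := by
    unfold localGibbsLaw
    rw [particleLaw_eq]
    exact withDensity_absolutelyContinuous _ _
  exact hac Φ.measure_compl_good

/-- The one-body observable `q ↦ φ(q.1) · g((√θ)⁻¹(q.2 − u₀))` is measurable for continuous `φ, g`. [folklore] -/
theorem measurable_obs {φ : T3 → ℝ} {g : V3 → ℝ} (hφ : Continuous φ) (hg : Continuous g) (θ : ℝ) (u₀ : V3) :
    Measurable fun q : T3 × EuclideanSpace ℝ (Fin 3) => φ q.1 * g ((Real.sqrt θ)⁻¹ • (q.2 - u₀)) :=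
  (hφ.measurable.comp measurable_fst).mul
    (hg.measurable.comp ((measurable_const_smul _).comp (measurable_snd.sub_const u₀)))

/-- `|φ(x) g(w)| ≤ κ` when `|φ| ≤ 1` and `|g| ≤ κ`. [folklore] -/
theorem abs_obs_le {φ : T3 → ℝ} {g : V3 → ℝ} {κ : ℝ} (hφ1 : ∀ x, |φ x| ≤ 1) (hgκ : ∀ v, |g v| ≤ κ)
    (θ : ℝ) (u₀ : V3) (q : T3 × EuclideanSpace ℝ (Fin 3)) :
    |φ q.1 * g ((Real.sqrt θ)⁻¹ • (q.2 - u₀))| ≤ κ := by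
  rw [abs_mul]
  calc |φ q.1| * |g ((Real.sqrt θ)⁻¹ • (q.2 - u₀))| ≤ 1 * κ :=
        mul_le_mul (hφ1 _) (hgκ _) (abs_nonneg _) zero_le_one
    _ = κ := one_mul κ

/-- The doubled velocity observable `2g` is admissible at amplitude `κ₀` once `|g| ≤ κ ≤ κ₀/2`, and inherits
continuity and orthogonality to the collision invariants. [folklore] -/
theorem double_admissible {g : V3 → ℝ} (hg : Continuous g) {κ κ₀ : ℝ} (hgκ : ∀ v, |g v| ≤ κ) (hκ : κ ≤ κ₀ / 2)
    (horth : ∀ (c₀ c₂ : ℝ) (b : V3),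
      ∫ v, g v * (c₀ + inner ℝ b v + c₂ * ‖v‖ ^ 2) ∂(ProbabilityTheory.stdGaussian V3) = 0) :
    Continuous (fun v => 2 * g v) ∧ (∀ v, |2 * g v| ≤ κ₀) ∧
      ∀ (c₀ c₂ : ℝ) (b : V3),
        ∫ v, 2 * g v * (c₀ + inner ℝ b v + c₂ * ‖v‖ ^ 2) ∂(ProbabilityTheory.stdGaussian V3) = 0 := by
  refine ⟨continuous_const.mul hg, fun v => ?_, fun c₀ c₂ b => ?_⟩
  · rw [abs_mul, abs_two]
    linarith [hgκ v]
  · have h := horth c₀ c₂ b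
    simp_rw [mul_assoc]
    rw [integral_const_mul, h, mul_zero]

/-! ## The window route: `KineticFluxLdDecay` from the forecast-window pressure and fixed-amplitude locality -/

open scoped Classical in
/-- **The window route.** Fixed-amplitude influence locality (`hL`, eventual in the range; believed FALSE, see the
module docstring) and the forecast-window
pressure `h₃` imply the shared crux `KineticFluxLdDecay` (stmt-10967): with `κ := min(κ₃/2, lam/4)`, the window
`τ := T(δ)` of `h₃` at the doubled observable, `R := max(R₀(h₃), R₀(hL))`, cluster flows from Alexander's theorem,
the core inequality `WindowLocality.wl_trueWindow_le` and `½(e^{δ(N+1)} + e^{δ(N+1)}) = e^{δ(N+1)}`. [folklore] -/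
theorem wl_kineticFlux_of_forecastWindow :
    (∀ (a θ : ℝ) (u₀ : V3), 0 < a → 0 < θ → ∃ σ₀ : ℝ, 0 < σ₀ ∧ ∀ σ : ℝ, 0 < σ → σ < σ₀ →
      ∃ lam : ℝ, 0 < lam ∧ ∀ (T δ : ℝ), 0 < T → 0 < δ → ∃ R₀ : ℝ, 0 < R₀ ∧ ∀ R : ℝ, R₀ ≤ R →
      ∃ N₀ : ℕ, ∀ N : ℕ, N₀ ≤ N →
      ∀ (Φ : HardSphereFlow (Torus.geometry (Fin 3)) (hsDiameter σ N) (N + 1))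
        (Ψ : (k : ℕ) → HardSphereFlow (Torus.geometry (Fin 3)) (hsDiameter σ N) k),
      ∫⁻ z, ENNReal.ofReal (Real.exp (lam * ((Finset.univ.filter fun i : Fin (N + 1) =>
          ∃ t ∈ Set.Icc (0 : ℝ) (T * ((N + 1 : ℕ) : ℝ) ^ (-(1 / 3 : ℝ))),
            Φ.flow t z i ≠ localClusterState Ψ (R * ((N + 1 : ℕ) : ℝ) ^ (-(1 / 3 : ℝ))) t z i).card : ℝ)))
        ∂(localGibbsLaw σ (fun _ => a) (fun _ => u₀) (fun _ => θ) N Φ)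
      ≤ ENNReal.ofReal (Real.exp (δ * (N + 1)))) →
    (∀ (a θ : ℝ) (u₀ : V3), 0 < a → 0 < θ → ∃ σ₀ : ℝ, 0 < σ₀ ∧ ∀ σ : ℝ, 0 < σ → σ < σ₀ →
      ∃ κ : ℝ, 0 < κ ∧ ∀ (φ : T3 → ℝ) (g : V3 → ℝ), Continuous φ → Continuous g → (∀ x, |φ x| ≤ 1) →
      (∀ v, |g v| ≤ κ) →
      (∀ (c₀ c₂ : ℝ) (b : V3),
        ∫ v, g v * (c₀ + inner ℝ b v + c₂ * ‖v‖ ^ 2) ∂(ProbabilityTheory.stdGaussian V3) = 0) →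
      ∀ δ : ℝ, 0 < δ → ∃ T : ℝ, 0 < T ∧ ∃ R₀ : ℝ, 0 < R₀ ∧ ∀ R : ℝ, R₀ ≤ R → ∃ N₀ : ℕ, ∀ N : ℕ, N₀ ≤ N →
      ∀ (Φ : HardSphereFlow (Torus.geometry (Fin 3)) (hsDiameter σ N) (N + 1))
        (Ψ : (k : ℕ) → HardSphereFlow (Torus.geometry (Fin 3)) (hsDiameter σ N) k),
      ∫⁻ z, ENNReal.ofReal (Real.exp (∑ i, (T * ((N + 1 : ℕ) : ℝ) ^ (-(1 / 3 : ℝ)))⁻¹ *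
          ∫ t in (0 : ℝ)..(T * ((N + 1 : ℕ) : ℝ) ^ (-(1 / 3 : ℝ))),
            φ (localClusterState Ψ (R * ((N + 1 : ℕ) : ℝ) ^ (-(1 / 3 : ℝ))) t z i).1 *
              g ((Real.sqrt θ)⁻¹ • ((localClusterState Ψ (R * ((N + 1 : ℕ) : ℝ) ^ (-(1 / 3 : ℝ))) t z i).2 - u₀))))
        ∂(localGibbsLaw σ (fun _ => a) (fun _ => u₀) (fun _ => θ) N Φ)
      ≤ ENNReal.ofReal (Real.exp (δ * (N + 1)))) →
    KineticFluxLdDecay := by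
  intro hL h₃ a θ u₀ ha hθ
  obtain ⟨σL, hσL, HL⟩ := hL a θ u₀ ha hθ
  obtain ⟨σ₃, hσ₃, H₃⟩ := h₃ a θ u₀ ha hθ
  refine ⟨min (min σL σ₃) (1 / 2), by positivity, fun σ hσ hσlt => ?_⟩
  have hσL' : σ < σL := hσlt.trans_le ((min_le_left _ _).trans (min_le_left _ _))
  have hσ₃' : σ < σ₃ := hσlt.trans_le ((min_le_left _ _).trans (min_le_right _ _))
  have hσhalf : σ < 1 / 2 := hσlt.trans_le (min_le_right _ _)
  obtain ⟨lam, hlam, HL'⟩ := HL σ hσ hσL'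
  obtain ⟨κ₃, hκ₃, H₃'⟩ := H₃ σ hσ hσ₃'
  have hP : ∀ (N : ℕ) (Φ : HardSphereFlow (Torus.geometry (Fin 3)) (hsDiameter σ N) (N + 1)),
      IsProbabilityMeasure (localGibbsLaw σ (fun _ => a) (fun _ => u₀) (fun _ => θ) N Φ) := fun N Φ =>
    isProbabilityMeasure_localGibbsLaw continuous_const continuous_const continuous_const (fun _ => ha)
      (fun _ => hθ) hσhalf.le N Φ
  refine ⟨hP, min (κ₃ / 2) (lam / 4), by positivity, fun φ g hφ hg hφ1 hgκ horth δ hδ => ?_⟩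
  -- the doubled observable is admissible for `h₃`
  obtain ⟨hg₂, hg₂κ, horth₂⟩ := double_admissible hg hgκ (min_le_left _ _) horth
  obtain ⟨T, hT, R₀₃, -, H₃''⟩ := H₃' φ (fun v => 2 * g v) hφ hg₂ hφ1 hg₂κ horth₂ δ hδ
  obtain ⟨R₀L, -, HL''⟩ := HL' T δ hT hδ
  obtain ⟨N₀₃, HN₃⟩ := H₃'' (max R₀₃ R₀L) (le_max_left _ _)
  obtain ⟨N₀L, HNL⟩ := HL'' (max R₀₃ R₀L) (le_max_right _ _)
  refine ⟨T, hT, max N₀₃ N₀L, fun N hN Φ => ?_⟩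
  -- cluster flows exist (Alexander on `𝕋³`, diameter `σℓ ≤ σ < 1/2`)
  have hεpos : 0 < hsDiameter σ N := hsDiameter_pos hσ N
  have hεhalf : hsDiameter σ N < 2⁻¹ := (hsDiameter_le hσ.le N).trans_lt (by rw [inv_eq_one_div]; exact hσhalf)
  let Ψ : (k : ℕ) → HardSphereFlow (Torus.geometry (Fin 3)) (hsDiameter σ N) k := fun k =>
    Classical.choice (HardSphereFlow.nonempty_torus_holds hεpos hεhalf k)
  have hgood := localGibbsLaw_compl_good σ a θ u₀ N Φ
  have hH : 0 < T * ((N + 1 : ℕ) : ℝ) ^ (-(1 / 3 : ℝ)) := mul_pos hT (Real.rpow_pos_of_pos (by positivity) _)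
  have h4 : 4 * min (κ₃ / 2) (lam / 4) ≤ lam := by linarith [min_le_right (κ₃ / 2) (lam / 4)]
  have core := wl_trueWindow_le Φ Ψ (localGibbsLaw σ (fun _ => a) (fun _ => u₀) (fun _ => θ) N Φ) hgood
    (fun q => φ q.1 * g ((Real.sqrt θ)⁻¹ • (q.2 - u₀)))
    (fun q => φ q.1 * (2 * g ((Real.sqrt θ)⁻¹ • (q.2 - u₀)))) (min (κ₃ / 2) (lam / 4))
    (T * ((N + 1 : ℕ) : ℝ) ^ (-(1 / 3 : ℝ))) ((max R₀₃ R₀L) * ((N + 1 : ℕ) : ℝ) ^ (-(1 / 3 : ℝ))) lam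
    (measurable_obs hφ hg θ u₀) (measurable_obs hφ hg₂ θ u₀) (abs_obs_le hφ1 hgκ θ u₀)
    (fun q => by ring) hH h4
  have b₃ := HN₃ N ((le_max_left _ _).trans hN) Φ Ψ
  have bL := HNL N ((le_max_right _ _).trans hN) Φ Ψ
  refine core.trans ?_
  calc _ ≤ 2⁻¹ * (ENNReal.ofReal (Real.exp (δ * (N + 1))) + ENNReal.ofReal (Real.exp (δ * (N + 1)))) := by
        gcongr
    _ = ENNReal.ofReal (Real.exp (δ * (N + 1))) := half_mul_add_self _

/-! ## The converse: the forecast-window pressure from `KineticFluxLdDecay` and fixed-amplitude locality -/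

open scoped Classical in
/-- **The converse.** Fixed-amplitude influence locality (`hL`, believed false) and the shared crux `KineticFluxLdDecay`
(stmt-10967) imply
the forecast-window pressure `h₃`: `κ := min(κ₁/2, lam/4)`, `T := τ(δ)` of stmt-10967 at the doubled observable,
`R₀ := R₀(hL)`, the core inequality `WindowLocality.wl_forecastWindow_le`. [folklore] -/
theorem wl_forecastWindow_of_kineticFlux :
    (∀ (a θ : ℝ) (u₀ : V3), 0 < a → 0 < θ → ∃ σ₀ : ℝ, 0 < σ₀ ∧ ∀ σ : ℝ, 0 < σ → σ < σ₀ →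
      ∃ lam : ℝ, 0 < lam ∧ ∀ (T δ : ℝ), 0 < T → 0 < δ → ∃ R₀ : ℝ, 0 < R₀ ∧ ∀ R : ℝ, R₀ ≤ R →
      ∃ N₀ : ℕ, ∀ N : ℕ, N₀ ≤ N →
      ∀ (Φ : HardSphereFlow (Torus.geometry (Fin 3)) (hsDiameter σ N) (N + 1))
        (Ψ : (k : ℕ) → HardSphereFlow (Torus.geometry (Fin 3)) (hsDiameter σ N) k),
      ∫⁻ z, ENNReal.ofReal (Real.exp (lam * ((Finset.univ.filter fun i : Fin (N + 1) =>
          ∃ t ∈ Set.Icc (0 : ℝ) (T * ((N + 1 : ℕ) : ℝ) ^ (-(1 / 3 : ℝ))),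
            Φ.flow t z i ≠ localClusterState Ψ (R * ((N + 1 : ℕ) : ℝ) ^ (-(1 / 3 : ℝ))) t z i).card : ℝ)))
        ∂(localGibbsLaw σ (fun _ => a) (fun _ => u₀) (fun _ => θ) N Φ)
      ≤ ENNReal.ofReal (Real.exp (δ * (N + 1)))) →
    KineticFluxLdDecay →
    (∀ (a θ : ℝ) (u₀ : V3), 0 < a → 0 < θ → ∃ σ₀ : ℝ, 0 < σ₀ ∧ ∀ σ : ℝ, 0 < σ → σ < σ₀ →
      ∃ κ : ℝ, 0 < κ ∧ ∀ (φ : T3 → ℝ) (g : V3 → ℝ), Continuous φ → Continuous g → (∀ x, |φ x| ≤ 1) →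
      (∀ v, |g v| ≤ κ) →
      (∀ (c₀ c₂ : ℝ) (b : V3),
        ∫ v, g v * (c₀ + inner ℝ b v + c₂ * ‖v‖ ^ 2) ∂(ProbabilityTheory.stdGaussian V3) = 0) →
      ∀ δ : ℝ, 0 < δ → ∃ T : ℝ, 0 < T ∧ ∃ R₀ : ℝ, 0 < R₀ ∧ ∀ R : ℝ, R₀ ≤ R → ∃ N₀ : ℕ, ∀ N : ℕ, N₀ ≤ N →
      ∀ (Φ : HardSphereFlow (Torus.geometry (Fin 3)) (hsDiameter σ N) (N + 1))
        (Ψ : (k : ℕ) → HardSphereFlow (Torus.geometry (Fin 3)) (hsDiameter σ N) k),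
      ∫⁻ z, ENNReal.ofReal (Real.exp (∑ i, (T * ((N + 1 : ℕ) : ℝ) ^ (-(1 / 3 : ℝ)))⁻¹ *
          ∫ t in (0 : ℝ)..(T * ((N + 1 : ℕ) : ℝ) ^ (-(1 / 3 : ℝ))),
            φ (localClusterState Ψ (R * ((N + 1 : ℕ) : ℝ) ^ (-(1 / 3 : ℝ))) t z i).1 *
              g ((Real.sqrt θ)⁻¹ • ((localClusterState Ψ (R * ((N + 1 : ℕ) : ℝ) ^ (-(1 / 3 : ℝ))) t z i).2 - u₀))))
        ∂(localGibbsLaw σ (fun _ => a) (fun _ => u₀) (fun _ => θ) N Φ)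
      ≤ ENNReal.ofReal (Real.exp (δ * (N + 1)))) := by
  intro hL h₁₀ a θ u₀ ha hθ
  obtain ⟨σL, hσL, HL⟩ := hL a θ u₀ ha hθ
  obtain ⟨σ₁, hσ₁, H₁⟩ := h₁₀ a θ u₀ ha hθ
  refine ⟨min σL σ₁, by positivity, fun σ hσ hσlt => ?_⟩
  have hσL' : σ < σL := hσlt.trans_le (min_le_left _ _)
  have hσ₁' : σ < σ₁ := hσlt.trans_le (min_le_right _ _)
  obtain ⟨lam, hlam, HL'⟩ := HL σ hσ hσL'
  obtain ⟨-, κ₁, hκ₁, H₁'⟩ := H₁ σ hσ hσ₁'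
  refine ⟨min (κ₁ / 2) (lam / 4), by positivity, fun φ g hφ hg hφ1 hgκ horth δ hδ => ?_⟩
  obtain ⟨hg₂, hg₂κ, horth₂⟩ := double_admissible hg hgκ (min_le_left _ _) horth
  obtain ⟨τ, hτ, N₀₁, HN₁⟩ := H₁' φ (fun v => 2 * g v) hφ hg₂ hφ1 hg₂κ horth₂ δ hδ
  obtain ⟨R₀, hR₀, HL''⟩ := HL' τ δ hτ hδ
  refine ⟨τ, hτ, R₀, hR₀, fun R hR => ?_⟩
  obtain ⟨N₀L, HNL⟩ := HL'' R hR
  refine ⟨max N₀₁ N₀L, fun N hN Φ Ψ => ?_⟩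
  have hgood := localGibbsLaw_compl_good σ a θ u₀ N Φ
  have hH : 0 < τ * ((N + 1 : ℕ) : ℝ) ^ (-(1 / 3 : ℝ)) := mul_pos hτ (Real.rpow_pos_of_pos (by positivity) _)
  have h4 : 4 * min (κ₁ / 2) (lam / 4) ≤ lam := by linarith [min_le_right (κ₁ / 2) (lam / 4)]
  have core := wl_forecastWindow_le Φ Ψ (localGibbsLaw σ (fun _ => a) (fun _ => u₀) (fun _ => θ) N Φ) hgood
    (fun q => φ q.1 * g ((Real.sqrt θ)⁻¹ • (q.2 - u₀)))
    (fun q => φ q.1 * (2 * g ((Real.sqrt θ)⁻¹ • (q.2 - u₀)))) (min (κ₁ / 2) (lam / 4))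
    (τ * ((N + 1 : ℕ) : ℝ) ^ (-(1 / 3 : ℝ))) (R * ((N + 1 : ℕ) : ℝ) ^ (-(1 / 3 : ℝ))) lam
    (measurable_obs hφ hg θ u₀) (measurable_obs hφ hg₂ θ u₀) (abs_obs_le hφ1 hgκ θ u₀)
    (fun q => by ring) hH h4
  have b₁ := HN₁ N ((le_max_left _ _).trans hN) Φ
  have bL := HNL N ((le_max_right _ _).trans hN) Φ Ψ
  refine core.trans ?_
  calc _ ≤ 2⁻¹ * (ENNReal.ofReal (Real.exp (δ * (N + 1))) + ENNReal.ofReal (Real.exp (δ * (N + 1)))) := by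
        gcongr
    _ = ENNReal.ofReal (Real.exp (δ * (N + 1))) := half_mul_add_self _

/-! ## Equivalences modulo fixed-amplitude locality -/

open scoped Classical in
/-- **Modulo fixed-amplitude influence locality (`hL`, believed false), the forecast-window pressure IS the crux.**
`h₃ ↔
CorrectorPressureDecay` (through `h₃ ↔ KineticFluxLdDecay`, `wl_kineticFlux_of_forecastWindow` /
`wl_forecastWindow_of_kineticFlux`, and the kernel-checked `CorrectorPressureDecay ↔ KineticFluxLdDecay`:
`⇒` = `pressureCertificateTransfer_proof` (stmt-14139), `⇐` = the discrete Fejér corrector fed by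
`discreteWindowPressureDecay_of_kineticFluxLdDecay` (p94243) and `correctorPressureDecay_of_discreteWindowPressureDecay`
(p97875) — the two halves of `CorrectorPressureDecayEquivalences.correctorPressureDecay_iff_kineticFluxLdDecay`, p99142).
[folklore] -/
theorem wl_forecastWindow_iff_crux :
    (∀ (a θ : ℝ) (u₀ : V3), 0 < a → 0 < θ → ∃ σ₀ : ℝ, 0 < σ₀ ∧ ∀ σ : ℝ, 0 < σ → σ < σ₀ →
      ∃ lam : ℝ, 0 < lam ∧ ∀ (T δ : ℝ), 0 < T → 0 < δ → ∃ R₀ : ℝ, 0 < R₀ ∧ ∀ R : ℝ, R₀ ≤ R →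
      ∃ N₀ : ℕ, ∀ N : ℕ, N₀ ≤ N →
      ∀ (Φ : HardSphereFlow (Torus.geometry (Fin 3)) (hsDiameter σ N) (N + 1))
        (Ψ : (k : ℕ) → HardSphereFlow (Torus.geometry (Fin 3)) (hsDiameter σ N) k),
      ∫⁻ z, ENNReal.ofReal (Real.exp (lam * ((Finset.univ.filter fun i : Fin (N + 1) =>
          ∃ t ∈ Set.Icc (0 : ℝ) (T * ((N + 1 : ℕ) : ℝ) ^ (-(1 / 3 : ℝ))),
            Φ.flow t z i ≠ localClusterState Ψ (R * ((N + 1 : ℕ) : ℝ) ^ (-(1 / 3 : ℝ))) t z i).card : ℝ)))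
        ∂(localGibbsLaw σ (fun _ => a) (fun _ => u₀) (fun _ => θ) N Φ)
      ≤ ENNReal.ofReal (Real.exp (δ * (N + 1)))) →
    ((∀ (a θ : ℝ) (u₀ : V3), 0 < a → 0 < θ → ∃ σ₀ : ℝ, 0 < σ₀ ∧ ∀ σ : ℝ, 0 < σ → σ < σ₀ →
      ∃ κ : ℝ, 0 < κ ∧ ∀ (φ : T3 → ℝ) (g : V3 → ℝ), Continuous φ → Continuous g → (∀ x, |φ x| ≤ 1) →
      (∀ v, |g v| ≤ κ) →
      (∀ (c₀ c₂ : ℝ) (b : V3),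
        ∫ v, g v * (c₀ + inner ℝ b v + c₂ * ‖v‖ ^ 2) ∂(ProbabilityTheory.stdGaussian V3) = 0) →
      ∀ δ : ℝ, 0 < δ → ∃ T : ℝ, 0 < T ∧ ∃ R₀ : ℝ, 0 < R₀ ∧ ∀ R : ℝ, R₀ ≤ R → ∃ N₀ : ℕ, ∀ N : ℕ, N₀ ≤ N →
      ∀ (Φ : HardSphereFlow (Torus.geometry (Fin 3)) (hsDiameter σ N) (N + 1))
        (Ψ : (k : ℕ) → HardSphereFlow (Torus.geometry (Fin 3)) (hsDiameter σ N) k),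
      ∫⁻ z, ENNReal.ofReal (Real.exp (∑ i, (T * ((N + 1 : ℕ) : ℝ) ^ (-(1 / 3 : ℝ)))⁻¹ *
          ∫ t in (0 : ℝ)..(T * ((N + 1 : ℕ) : ℝ) ^ (-(1 / 3 : ℝ))),
            φ (localClusterState Ψ (R * ((N + 1 : ℕ) : ℝ) ^ (-(1 / 3 : ℝ))) t z i).1 *
              g ((Real.sqrt θ)⁻¹ • ((localClusterState Ψ (R * ((N + 1 : ℕ) : ℝ) ^ (-(1 / 3 : ℝ))) t z i).2 - u₀))))
        ∂(localGibbsLaw σ (fun _ => a) (fun _ => u₀) (fun _ => θ) N Φ)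
      ≤ ENNReal.ofReal (Real.exp (δ * (N + 1)))) ↔
    CorrectorPressureDecay) :=
  fun hL => ⟨fun h₃ => CorrectorPressureDecayTransfer.correctorPressureDecay_of_discreteWindowPressureDecay
      (CorrectorPressureDecayNegative.DiscreteWindow.discreteWindowPressureDecay_of_kineticFluxLdDecay
        (wl_kineticFlux_of_forecastWindow hL h₃)),
    fun hX => wl_forecastWindow_of_kineticFlux hL (pressureCertificateTransfer_proof hX)⟩

open scoped Classical in
/-- **Layer 2 of `CorrectorPressureDecay`, window route.** The crux from fixed-amplitude influence locality (`hL`,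
believed false — the implication isolates exactly what pathwise localisation needs) and
the forecast-window pressure alone (compare `ShotNoisePressure.correctorPressureDecay_of_locality_of_forecastWindow`,
which needs the eventual `∀ lam` locality and, inside, the within-lag shot-noise pressure). [folklore] -/
theorem correctorPressureDecay_of_smallAmplitudeLocality_of_forecastWindow
    (hL : ∀ (a θ : ℝ) (u₀ : V3), 0 < a → 0 < θ → ∃ σ₀ : ℝ, 0 < σ₀ ∧ ∀ σ : ℝ, 0 < σ → σ < σ₀ →
      ∃ lam : ℝ, 0 < lam ∧ ∀ (T δ : ℝ), 0 < T → 0 < δ → ∃ R₀ : ℝ, 0 < R₀ ∧ ∀ R : ℝ, R₀ ≤ R →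
      ∃ N₀ : ℕ, ∀ N : ℕ, N₀ ≤ N →
      ∀ (Φ : HardSphereFlow (Torus.geometry (Fin 3)) (hsDiameter σ N) (N + 1))
        (Ψ : (k : ℕ) → HardSphereFlow (Torus.geometry (Fin 3)) (hsDiameter σ N) k),
      ∫⁻ z, ENNReal.ofReal (Real.exp (lam * ((Finset.univ.filter fun i : Fin (N + 1) =>
          ∃ t ∈ Set.Icc (0 : ℝ) (T * ((N + 1 : ℕ) : ℝ) ^ (-(1 / 3 : ℝ))),
            Φ.flow t z i ≠ localClusterState Ψ (R * ((N + 1 : ℕ) : ℝ) ^ (-(1 / 3 : ℝ))) t z i).card : ℝ)))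
        ∂(localGibbsLaw σ (fun _ => a) (fun _ => u₀) (fun _ => θ) N Φ)
      ≤ ENNReal.ofReal (Real.exp (δ * (N + 1))))
    (h₃ : ∀ (a θ : ℝ) (u₀ : V3), 0 < a → 0 < θ → ∃ σ₀ : ℝ, 0 < σ₀ ∧ ∀ σ : ℝ, 0 < σ → σ < σ₀ →
      ∃ κ : ℝ, 0 < κ ∧ ∀ (φ : T3 → ℝ) (g : V3 → ℝ), Continuous φ → Continuous g → (∀ x, |φ x| ≤ 1) →
      (∀ v, |g v| ≤ κ) →
      (∀ (c₀ c₂ : ℝ) (b : V3),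
        ∫ v, g v * (c₀ + inner ℝ b v + c₂ * ‖v‖ ^ 2) ∂(ProbabilityTheory.stdGaussian V3) = 0) →
      ∀ δ : ℝ, 0 < δ → ∃ T : ℝ, 0 < T ∧ ∃ R₀ : ℝ, 0 < R₀ ∧ ∀ R : ℝ, R₀ ≤ R → ∃ N₀ : ℕ, ∀ N : ℕ, N₀ ≤ N →
      ∀ (Φ : HardSphereFlow (Torus.geometry (Fin 3)) (hsDiameter σ N) (N + 1))
        (Ψ : (k : ℕ) → HardSphereFlow (Torus.geometry (Fin 3)) (hsDiameter σ N) k),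
      ∫⁻ z, ENNReal.ofReal (Real.exp (∑ i, (T * ((N + 1 : ℕ) : ℝ) ^ (-(1 / 3 : ℝ)))⁻¹ *
          ∫ t in (0 : ℝ)..(T * ((N + 1 : ℕ) : ℝ) ^ (-(1 / 3 : ℝ))),
            φ (localClusterState Ψ (R * ((N + 1 : ℕ) : ℝ) ^ (-(1 / 3 : ℝ))) t z i).1 *
              g ((Real.sqrt θ)⁻¹ • ((localClusterState Ψ (R * ((N + 1 : ℕ) : ℝ) ^ (-(1 / 3 : ℝ))) t z i).2 - u₀))))
        ∂(localGibbsLaw σ (fun _ => a) (fun _ => u₀) (fun _ => θ) N Φ)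
      ≤ ENNReal.ofReal (Real.exp (δ * (N + 1)))) :
    CorrectorPressureDecay :=
  (wl_forecastWindow_iff_crux hL).1 h₃

open scoped Classical in
/-- The eventual form `InfluenceLocalityEventually` (all amplitudes; target of the 13916 line
`true-anchored-infection`, hypothesis `h₁` of the corrector transfer) implies fixed-amplitude locality (take
`lam = 1`). [folklore] -/
theorem wl_smallAmplitude_of_eventually (h : TrueAnchoredInfection.InfluenceLocalityEventually) :
    ∀ (a θ : ℝ) (u₀ : V3), 0 < a → 0 < θ → ∃ σ₀ : ℝ, 0 < σ₀ ∧ ∀ σ : ℝ, 0 < σ → σ < σ₀ →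
      ∃ lam : ℝ, 0 < lam ∧ ∀ (T δ : ℝ), 0 < T → 0 < δ → ∃ R₀ : ℝ, 0 < R₀ ∧ ∀ R : ℝ, R₀ ≤ R →
      ∃ N₀ : ℕ, ∀ N : ℕ, N₀ ≤ N →
      ∀ (Φ : HardSphereFlow (Torus.geometry (Fin 3)) (hsDiameter σ N) (N + 1))
        (Ψ : (k : ℕ) → HardSphereFlow (Torus.geometry (Fin 3)) (hsDiameter σ N) k),
      ∫⁻ z, ENNReal.ofReal (Real.exp (lam * ((Finset.univ.filter fun i : Fin (N + 1) =>
          ∃ t ∈ Set.Icc (0 : ℝ) (T * ((N + 1 : ℕ) : ℝ) ^ (-(1 / 3 : ℝ))),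
            Φ.flow t z i ≠ localClusterState Ψ (R * ((N + 1 : ℕ) : ℝ) ^ (-(1 / 3 : ℝ))) t z i).card : ℝ)))
        ∂(localGibbsLaw σ (fun _ => a) (fun _ => u₀) (fun _ => θ) N Φ)
      ≤ ENNReal.ofReal (Real.exp (δ * (N + 1))) := by
  intro a θ u₀ ha hθ
  obtain ⟨σ₀, hσ₀, H⟩ := h a θ u₀ ha hθ
  refine ⟨σ₀, hσ₀, fun σ hσ hσlt => ⟨1, one_pos, fun T δ hT hδ => ?_⟩⟩
  obtain ⟨R₀, hR₀, HR⟩ := H σ hσ hσlt T 1 δ hT one_pos hδ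
  refine ⟨R₀, hR₀, fun R hR => ?_⟩
  obtain ⟨N₀, HN⟩ := HR R hR
  exact ⟨N₀, fun N hN Φ Ψ => HN N hN Φ Ψ⟩

open scoped Classical in
/-- Read-back: with the eventual locality of the 13916 line the window route closes the crux from `h₃` alone,
exactly like `ShotNoisePressure.correctorPressureDecay_of_locality_of_forecastWindow` but without the shot-noise
theorem. [folklore] -/
example (h₁ : TrueAnchoredInfection.InfluenceLocalityEventually) := fun h₃ =>
  (correctorPressureDecay_of_smallAmplitudeLocality_of_forecastWindow (wl_smallAmplitude_of_eventually h₁) h₃ :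
    CorrectorPressureDecay)

end WindowLocality

end Summit.AtomisticToContinuum.HydrodynamicLimit.Theorems

end
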